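/-
Copyright (c) 2026 the pub-hodgecm-mathlib formalisation cell (harness21).  Prover seat hodgecm-mathlib-LH4-p18 (g3), Track A «FOUR-FRAME» hand on VALVE loan to
Track B «K2-LIT», #184♮ = hLiu418 = `stmt-HodgeConjecture-24832`; socket #42F′, FACE-G L2 (W-orb), RULING M-158y «(C2) CLOSURE ORGAN», the JOINT between (C2-i) and
(C2-org) named by box K2E5-r02 (g6) 2026-09-04T23:49:34Z («SET-vs-SPAN + ℂ-linearity: ONE S-size glue lemma»); file (C2-glue).
THEOREMS ONLY (no `def`, no `instance`, no notation, no named-fact hypothesis, no `sorry`).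
-/
import Mathlib.Analysis.Calculus.Deriv.Add
import Mathlib.Analysis.Calculus.Deriv.Basic
import Mathlib.Topology.Algebra.Module.Basic
import Mathlib.LinearAlgebra.Span.Basic
import Mathlib.Analysis.Complex.Basic
import HarnessLib

/-!
# Crux `HLiu418`, socket #42F′, FACE-G L2 (W-orb), (C2) CLOSURE ORGAN, file (C2-glue) — `K2LiuArchOrbitLawSpan`:
# A WEAK DERIVATIVE LAW ON A SET OF VECTORS EXTENDS TO ITS `ℂ`-SPAN (when the group and the generator are `ℂ`-linear)

Cell `hodgecm-mathlib`, crux item hLiu418 = `stmt-HodgeConjecture-24832` (helper lane `--supports … --as helper`, count-neutral), route of record `HCCMUnconditional`;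
squad K2 ∕ K2Liu, road `K2_Liu`, socket #42F′, FACE-G, hole (W-orb), road (C2).  THE SEAM (box K2E5-r02 (g6) on ★ p863244 (C2-org) `K2LiuArchOrbitDerivClosure` + (C2-i) ★-cand
`K2LiuArchSchwartzPlaceProductDense`): (C2-org) §5 `thetaOrbitLetter_of_dense (D) (hD : Dense D) (A) (hlaw : ∀ d ∈ D, ∀ T, HasDerivAt (t ↦ T (U t d)) (T (A d)) 0) …` is fed
`D := ↑(span ℂ P)` by (C2-i) (`Dense` of the bare product SET `P` is false; the SPAN is dense), while (C2-B) (LH4-p05 (g10)) proves the Leibniz law on the PRODUCTS `d ∈ P`.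
THIS FILE is the extension «law on `P` ⇒ law on `span ℂ P`», currency-free: `E` any topological `ℂ`-module, `F` any real normed space of test values, `U : ℝ → E →L[ℝ] E` the
one-parameter family and `A : E →L[ℝ] E` the generator seen (as in §5) only as `ℝ`-CLMs, plus their `ℂ`-LINEARITY as two by-value letters (`archWeilRep … g` is `ℂ`-linear —
`map_smul`; `A_Y` is LH4-p05's `ℂ`-linear operator):
* §1 `hasDerivAt_orbit_zero'`, `hasDerivAt_orbit_add`, `hasDerivAt_orbit_smul` — the three closure steps (zero: the constant orbit, `A 0 = 0`; add: `HasDerivAt.add`; smul by `c : ℂ`: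
  the law for `d` tested against the `ℝ`-CLM `T ∘L (c • ·)`).
* §2 **`hasDerivAt_orbit_of_mem_span`** — `(hU) (hA) (hlaw : ∀ d ∈ P, ∀ T, HasDerivAt (s ↦ T (U s d)) (T (A d)) t₀)` ⊢ `∀ d ∈ span ℂ P, ∀ T, HasDerivAt (s ↦ T (U s d)) (T (A d)) t₀`
  (`Submodule.span_induction`), at any base point `t₀` (the organ uses `t₀ = 0`).
[ReedSimonI1980, §VIII.3] [EngelNagel2000, Ch. II §1].
HONEST LABEL.  Count-neutral helper, closes no socket (15 lines of linear algebra): `HC_CM` is proved only modulo the 7 printed citations (2 remaining named inputs: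
hLiu418 = `stmt-HodgeConjecture-24832`, h413 = `stmt-HodgeConjecture-24833`) until rung 0 closes.

## References
* [ReedSimonI1980] M. Reed, B. Simon, *Methods of Modern Mathematical Physics I: Functional Analysis* (1980): §VIII.3 (generators of one-parameter groups; cores and linear spans).
* [EngelNagel2000] K.-J. Engel, R. Nagel, *One-Parameter Semigroups for Linear Evolution Equations*, GTM 194 (2000): Ch. II §1 (the generator on a dense invariant subspace).
-/

set_option autoImplicit false
set_option linter.dupNamespace false -- the mandated namespace repeats `HodgeConjecture.HodgeConjecture`

noncomputable section

namespace Summit.HodgeConjecture.HodgeConjecture.Cruxes.HLiu418.K2LiuArchOrbitLawSpan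

variable {E : Type*} [AddCommGroup E] [Module ℂ E] [TopologicalSpace E]
  {F : Type*} [NormedAddCommGroup F] [NormedSpace ℝ F]

/-! ## §1 The three closure steps -/

/-- the ZERO vector: the orbit is constant `T (U s 0) = 0` and the derivative `T (A 0) = 0`. [folklore] -/
theorem hasDerivAt_orbit_zero' (U : ℝ → E →L[ℝ] E) (A : E →L[ℝ] E) (T : E →L[ℝ] F) (t₀ : ℝ) :
    HasDerivAt (fun s : ℝ => T (U s 0)) (T (A 0)) t₀ := by
  simp only [map_zero]
  exact hasDerivAt_const t₀ 0

/-- ADDITIVITY: the law for `x` and `y` gives the law for `x + y` (`U s`, `A`, `T` additive; `HasDerivAt.add`). [folklore] -/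
theorem hasDerivAt_orbit_add (U : ℝ → E →L[ℝ] E) (A : E →L[ℝ] E) (T : E →L[ℝ] F) (t₀ : ℝ) {x y : E}
    (hx : HasDerivAt (fun s : ℝ => T (U s x)) (T (A x)) t₀) (hy : HasDerivAt (fun s : ℝ => T (U s y)) (T (A y)) t₀) :
    HasDerivAt (fun s : ℝ => T (U s (x + y))) (T (A (x + y))) t₀ := by
  have h := hx.add hy
  simp only [map_add]
  exact h

/-- `ℂ`-HOMOGENEITY: if `U s` and `A` commute with the scalar `c : ℂ` and `c • ·` is continuous, the law for `x` tested against EVERY `ℝ`-CLM gives the law for `c • x` — test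
`x` against `T ∘L (c • ·)`. [folklore] -/
theorem hasDerivAt_orbit_smul [ContinuousConstSMul ℂ E] (U : ℝ → E →L[ℝ] E) (A : E →L[ℝ] E)
    (hU : ∀ (s : ℝ) (c : ℂ) (x : E), U s (c • x) = c • U s x) (hA : ∀ (c : ℂ) (x : E), A (c • x) = c • A x)
    (t₀ : ℝ) (c : ℂ) {x : E} (hx : ∀ T : E →L[ℝ] F, HasDerivAt (fun s : ℝ => T (U s x)) (T (A x)) t₀) (T : E →L[ℝ] F) :
    HasDerivAt (fun s : ℝ => T (U s (c • x))) (T (A (c • x))) t₀ := by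
  -- the `ℝ`-continuous linear map `c • ·` on `E`
  let Sc : E →L[ℝ] E :=
    { toFun := fun y => c • y
      map_add' := fun y z => smul_add c y z
      map_smul' := fun (r : ℝ) y => smul_comm c r y
      cont := continuous_const_smul c }
  have h := hx (T.comp Sc)
  have h1 : (fun s : ℝ => (T.comp Sc) (U s x)) = fun s : ℝ => T (U s (c • x)) := by
    funext s
    rw [ContinuousLinearMap.comp_apply, hU]
    rfl
  have h2 : (T.comp Sc) (A x) = T (A (c • x)) := by
    rw [ContinuousLinearMap.comp_apply, hA]
    rfl
  rw [h1, h2] at h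
  exact h

/-! ## §2 The law on a set extends to its `ℂ`-span -/

/-- **A WEAK DERIVATIVE LAW ON `P` EXTENDS TO `span ℂ P`.**  `E` a topological `ℂ`-module with continuous scalar action, `U : ℝ → E →L[ℝ] E` and `A : E →L[ℝ] E` commuting with the
`ℂ`-scalars (`hU`, `hA` — `ℂ`-linearity seen through `ℝ`-CLMs), `F` a real normed space of test values.  If for every `d ∈ P` and every test `T : E →L[ℝ] F` the scalar orbit
`s ↦ T (U s d)` has derivative `T (A d)` at `t₀`, then the same holds for every `d ∈ span ℂ P` — the `hlaw` of ★ (C2-org) `K2LiuArchOrbitDerivClosure.thetaOrbitLetter_of_dense` on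
the DENSE `D := ↑(span ℂ P)` of ★ (C2-i) `K2LiuArchSchwartzPlaceProductDense.dense_span_symm_tensorPi` from (C2-B)'s law on the product vectors `P`.
[cite: ReedSimonI1980, §VIII.3] [cite: EngelNagel2000, Ch. II §1] -/
theorem hasDerivAt_orbit_of_mem_span [ContinuousConstSMul ℂ E] (U : ℝ → E →L[ℝ] E) (A : E →L[ℝ] E)
    (hU : ∀ (s : ℝ) (c : ℂ) (x : E), U s (c • x) = c • U s x) (hA : ∀ (c : ℂ) (x : E), A (c • x) = c • A x)
    (t₀ : ℝ) (P : Set E) (hlaw : ∀ d ∈ P, ∀ T : E →L[ℝ] F, HasDerivAt (fun s : ℝ => T (U s d)) (T (A d)) t₀)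
    {d : E} (hd : d ∈ Submodule.span ℂ P) (T : E →L[ℝ] F) :
    HasDerivAt (fun s : ℝ => T (U s d)) (T (A d)) t₀ := by
  revert T
  refine Submodule.span_induction (p := fun x _ => ∀ T : E →L[ℝ] F, HasDerivAt (fun s : ℝ => T (U s x)) (T (A x)) t₀) ?_ ?_ ?_ ?_ hd
  · exact fun x hx T => hlaw x hx T
  · exact fun T => hasDerivAt_orbit_zero' U A T t₀
  · exact fun x y _ _ hx hy T => hasDerivAt_orbit_add U A T t₀ (hx T) (hy T)
  · exact fun c x _ hx T => hasDerivAt_orbit_smul U A hU hA t₀ c hx T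

/-- the same packaged as the `hlaw` binder SHAPE of ★ (C2-org) §5 (`∀ d ∈ D, ∀ T, HasDerivAt … 0`) with `D := ↑(span ℂ P)`. [cite: ReedSimonI1980, §VIII.3] -/
theorem hlaw_span_of_hlaw [ContinuousConstSMul ℂ E] (U : ℝ → E →L[ℝ] E) (A : E →L[ℝ] E)
    (hU : ∀ (s : ℝ) (c : ℂ) (x : E), U s (c • x) = c • U s x) (hA : ∀ (c : ℂ) (x : E), A (c • x) = c • A x)
    (P : Set E) (hlaw : ∀ d ∈ P, ∀ T : E →L[ℝ] F, HasDerivAt (fun s : ℝ => T (U s d)) (T (A d)) 0) :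
    ∀ d ∈ ((Submodule.span ℂ P : Submodule ℂ E) : Set E), ∀ T : E →L[ℝ] F, HasDerivAt (fun s : ℝ => T (U s d)) (T (A d)) 0 :=
  fun _ hd T => hasDerivAt_orbit_of_mem_span U A hU hA 0 P hlaw hd T

end Summit.HodgeConjecture.HodgeConjecture.Cruxes.HLiu418.K2LiuArchOrbitLawSpan

end
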